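import Literature.Barriers.QuantumAdvantage.BoundedEntanglementLocality
import HarnessLib

/-!
# The block structure of a `p`-blocked computation, gate by gate (Jozsa–Linden, lemma `ratpbl`)

Topic `Literature/Barriers/QuantumAdvantage`; fourth file of the proof programme for the named
fact `Literature.Barriers.QuantumAdvantage.jozsaLinden2003_pblocked` (Jozsa–Linden 2003, §3).
The classical simulation of lemma `ratpbl` maintains "(a) (Block locations)" and updates them at
each gate: a gate inside a block leaves (a) unchanged (Case 1); a gate straddling blocks `B₁`,
`B₂` amalgamates them and then "identif[ies] a new block structure (with blocks of size `≤ p`)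
within the qubits of `B₁ ∪ B₂`" (Case 2). This file defines that block structure as a function of
the stage and proves what the machine half relies on:

* `IsBlockPartition ψ P` — `P` is a set of nonempty, pairwise disjoint wire sets covering the
  register, across each of which `ψ` splits;
* `blocksAfter F x j` — the blocks after `j` gates: singletons at `j = 0`; at a gate with wire
  set `E`, the blocks meeting `E` ("touching") are replaced by the atoms (finest blocks,
  `BoundedEntanglementSplitting.atom`) of the new state inside their union `C`, all other blocks
  are kept (we re-block after *every* gate, one- or two-qubit: a uniform Case 2);
* `isBlockPartition_blocksAfter` — it is a block partition of the state after `j` gates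
  (locality of the gate for the kept blocks, `Splits.placeGate_mulVec_of_disjoint`; atoms split);
* the bookkeeping the machine needs: `wires_subset_touchUnion` (`E ⊆ C`),
  `splits_touchUnion` / `splits_touchUnion_succ` (`C` splits the state before and after the
  gate), `card_touching_le` (at most `arity ≤ 2` blocks are touched), and under
  `HasPBlockedStates p`: `card_le_of_mem_blocksAfter` (every block has `≤ p` wires) and
  `card_touchUnion_le` (`|C| ≤ 2p`, so all tables of the simulation have bounded size).

## References

* R. Jozsa, N. Linden, *On the role of entanglement in quantum-computational speed-up*, Proc. R.
  Soc. Lond. A 459 (2003) 2011–2032, arXiv:quant-ph/0201143: §3, proof of lemma `ratpbl`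
  ((a) block locations; Cases 1 and 2), theorem `pblthm`.
-/

noncomputable section

namespace Literature.Barriers.QuantumAdvantage

open Finset Matrix Literature.Computability.Cryptography Literature.Computability.QuantumComplexity

variable {N : ℕ}

/-! ### Block partitions -/

/-- `IsBlockPartition ψ P`: the wire sets in `P` are nonempty, pairwise disjoint, cover the
register, and `ψ` splits across each of them — a block description "(a)" of the pure state `ψ`
(not necessarily the finest one). [cite: JozsaLinden2003, §3 (proof of lemma ratpbl, (a) block locations)] -/
structure IsBlockPartition (ψ : QReg N → ℂ) (P : Finset (Finset (Fin N))) : Prop where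
  /-- every wire lies in some block -/
  cover : ∀ i : Fin N, ∃ B ∈ P, i ∈ B
  /-- distinct blocks are disjoint -/
  disjoint : ∀ B ∈ P, ∀ B' ∈ P, B ≠ B' → Disjoint B B'
  /-- blocks are nonempty -/
  nonempty : ∀ B ∈ P, B.Nonempty
  /-- the state is a product across each block and the rest -/
  splits : ∀ B ∈ P, Splits ψ B

/-- The block of a wire in a block partition is unique. [folklore] -/
theorem IsBlockPartition.eq_of_mem {ψ : QReg N → ℂ} {P : Finset (Finset (Fin N))}
    (h : IsBlockPartition ψ P) {B B' : Finset (Fin N)} (hB : B ∈ P) (hB' : B' ∈ P) {i : Fin N}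
    (hi : i ∈ B) (hi' : i ∈ B') : B = B' := by
  by_contra hne
  exact Finset.disjoint_left.1 (h.disjoint B hB B' hB' hne) hi hi'

/-- A union of splitting sets splits. [folklore] -/
theorem splits_sup_id {ψ : QReg N → ℂ} (T : Finset (Finset (Fin N))) (h : ∀ B ∈ T, Splits ψ B) :
    Splits ψ (T.sup id) := by
  classical
  induction T using Finset.induction_on with
  | empty => simpa using splits_empty ψ
  | insert B T hB ih =>
    rw [Finset.sup_insert, id]
    exact (h B (mem_insert_self B T)).union (ih fun B' hB' => h B' (mem_insert_of_mem hB'))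

/-- **Singletons form a block partition of a basis state** (every set splits a basis state).
[cite: JozsaLinden2003, §3 (proof of lemma ratpbl: the initial state |i₁…iₙ⟩|0…0⟩)] -/
theorem splits_basisState (w : QReg N) (S : Finset (Fin N)) : Splits (basisState w) S := by
  classical
  refine ⟨fun x => if ∀ i ∈ S, x i = w i then 1 else 0, fun x => if ∀ i ∉ S, x i = w i then 1 else 0,
    ?_, ?_, ?_⟩
  · intro x y hxy
    have : (∀ i ∈ S, x i = w i) ↔ ∀ i ∈ S, y i = w i :=
      ⟨fun h i hi => (hxy i hi) ▸ h i hi, fun h i hi => (hxy i hi).symm ▸ h i hi⟩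
    simp only [this]
  · intro x y hxy
    have : (∀ i ∉ S, x i = w i) ↔ ∀ i ∉ S, y i = w i :=
      ⟨fun h i hi => (hxy i hi) ▸ h i hi, fun h i hi => (hxy i hi).symm ▸ h i hi⟩
    simp only [this]
  · intro x
    change basisState w x =
      (if ∀ i ∈ S, x i = w i then (1 : ℂ) else 0) * (if ∀ i ∉ S, x i = w i then (1 : ℂ) else 0)
    rw [basisState_apply]
    by_cases hx : x = w
    · subst hx
      simp
    · have : ¬ ((∀ i ∈ S, x i = w i) ∧ ∀ i ∉ S, x i = w i) := fun ⟨h1, h2⟩ =>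
        hx (funext fun i => if hi : i ∈ S then h1 i hi else h2 i hi)
      rw [if_neg hx]
      by_cases h1 : ∀ i ∈ S, x i = w i
      · rw [if_pos h1, if_neg fun h2 => this ⟨h1, h2⟩, mul_zero]
      · rw [if_neg h1, zero_mul]

/-- The singletons are a block partition of any basis state. [cite: JozsaLinden2003, §3 (proof of lemma ratpbl: the initial state)] -/
theorem isBlockPartition_singletons (w : QReg N) :
    IsBlockPartition (basisState w) (univ.image fun i : Fin N => ({i} : Finset (Fin N))) where
  cover i := ⟨{i}, mem_image_of_mem _ (mem_univ i), mem_singleton_self i⟩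
  disjoint B hB B' hB' hne := by
    obtain ⟨i, -, rfl⟩ := mem_image.1 hB
    obtain ⟨i', -, rfl⟩ := mem_image.1 hB'
    exact disjoint_singleton.2 fun h => hne (by rw [h])
  nonempty B hB := by
    obtain ⟨i, -, rfl⟩ := mem_image.1 hB
    exact singleton_nonempty i
  splits B _ := splits_basisState w B

/-! ### The blocks after `j` gates -/

section Blocks

variable {G : QGateSet} (F : QCircuitFamily G) (x : List Bool)

/-- The blocks of the current partition meeting the wire set `E` ("touching"). [cite: JozsaLinden2003, §3 (proof of lemma ratpbl, Cases 1 and 2)] -/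
def touching (P : Finset (Finset (Fin N))) (E : Finset (Fin N)) : Finset (Finset (Fin N)) :=
  P.filter fun B => (B ∩ E).Nonempty

/-- Their union `C` (the wires of `B₁ ∪ B₂` in Case 2, of the block in Case 1). [cite: JozsaLinden2003, §3 (proof of lemma ratpbl, Cases 1 and 2)] -/
def touchUnion (P : Finset (Finset (Fin N))) (E : Finset (Fin N)) : Finset (Fin N) :=
  (touching P E).sup id

/-- **The block structure after `j` gates.** Singletons before the first gate; at gate `j` with
wire set `E`, the touching blocks are replaced by the atoms of the new state at the wires of
their union, the other blocks are kept; constant beyond the size.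
[cite: JozsaLinden2003, §3 (proof of lemma ratpbl, (a) and Cases 1, 2)] -/
def blocksAfter (F : QCircuitFamily G) (x : List Bool) :
    ℕ → Finset (Finset (Fin (x.length + F.ancillas x.length)))
  | 0 => univ.image fun i => ({i} : Finset (Fin (x.length + F.ancillas x.length)))
  | j + 1 =>
    if hj : j < (F.circ x.length).gates.length then
      (blocksAfter F x j \ touching (blocksAfter F x j) ((F.circ x.length).gates[j]).wires) ∪
        (touchUnion (blocksAfter F x j) ((F.circ x.length).gates[j]).wires).image
          fun i => atom (F.stateAfter x (j + 1)) i
    else blocksAfter F x j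

/-- Unfolding at a gate. [folklore] -/
theorem blocksAfter_succ {j : ℕ} (hj : j < (F.circ x.length).gates.length) :
    blocksAfter F x (j + 1) =
      (blocksAfter F x j \ touching (blocksAfter F x j) ((F.circ x.length).gates[j]).wires) ∪
        (touchUnion (blocksAfter F x j) ((F.circ x.length).gates[j]).wires).image
          fun i => atom (F.stateAfter x (j + 1)) i := by
  simp only [blocksAfter, dif_pos hj]

/-- Unfolding beyond the size. [folklore] -/
theorem blocksAfter_succ_of_le {j : ℕ} (hj : (F.circ x.length).gates.length ≤ j) :
    blocksAfter F x (j + 1) = blocksAfter F x j := by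
  simp only [blocksAfter, dif_neg (not_lt.2 hj)]

/-- Beyond the size the blocks are final. [folklore] -/
theorem blocksAfter_of_length_le {j : ℕ} (hj : (F.circ x.length).gates.length ≤ j) :
    blocksAfter F x j = blocksAfter F x (F.circ x.length).gates.length := by
  obtain ⟨d, rfl⟩ := Nat.exists_eq_add_of_le hj
  induction d with
  | zero => rfl
  | succ d ih =>
    rw [← add_assoc, blocksAfter_succ_of_le F x (by omega)]
    exact ih (by omega)

variable {F x}

/-! ### Bookkeeping of the touching blocks -/

/-- A touching block is a block. [folklore] -/
theorem mem_of_mem_touching {P : Finset (Finset (Fin N))} {E B : Finset (Fin N)}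
    (h : B ∈ touching P E) : B ∈ P :=
  (mem_filter.1 h).1

/-- A touching block lies inside the union `C`. [folklore] -/
theorem subset_touchUnion_of_mem {P : Finset (Finset (Fin N))} {E B : Finset (Fin N)}
    (h : B ∈ touching P E) : B ⊆ touchUnion P E :=
  Finset.le_sup (f := id) h

/-- Membership in the union `C`. [folklore] -/
theorem mem_touchUnion_iff {P : Finset (Finset (Fin N))} {E : Finset (Fin N)} {i : Fin N} :
    i ∈ touchUnion P E ↔ ∃ B ∈ touching P E, i ∈ B := by
  unfold touchUnion
  rw [Finset.mem_sup]
  simp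

/-- **`E ⊆ C`**: in a block partition every wire of the gate lies in a touching block. [folklore] -/
theorem subset_touchUnion {ψ : QReg N → ℂ} {P : Finset (Finset (Fin N))} (hP : IsBlockPartition ψ P)
    (E : Finset (Fin N)) : E ⊆ touchUnion P E := by
  intro i hi
  obtain ⟨B, hB, hiB⟩ := hP.cover i
  exact mem_touchUnion_iff.2 ⟨B, mem_filter.2 ⟨hB, ⟨i, mem_inter.2 ⟨hiB, hi⟩⟩⟩, hiB⟩

/-- A kept (non-touching) block avoids the wires of the gate. [folklore] -/
theorem disjoint_of_not_mem_touching {P : Finset (Finset (Fin N))} {E B : Finset (Fin N)}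
    (hB : B ∈ P) (h : B ∉ touching P E) : Disjoint B E := by
  rw [touching, mem_filter, not_and] at h
  exact disjoint_iff_inter_eq_empty.2 (not_nonempty_iff_eq_empty.1 (h hB))

/-- A kept block avoids the whole union `C`. [folklore] -/
theorem disjoint_touchUnion_of_not_mem_touching {ψ : QReg N → ℂ} {P : Finset (Finset (Fin N))}
    (hP : IsBlockPartition ψ P) {E B : Finset (Fin N)} (hB : B ∈ P) (h : B ∉ touching P E) :
    Disjoint B (touchUnion P E) := by
  rw [Finset.disjoint_left]
  intro i hiB hiC
  obtain ⟨B', hB', hiB'⟩ := mem_touchUnion_iff.1 hiC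
  have := hP.eq_of_mem hB (mem_of_mem_touching hB') hiB hiB'
  subst this
  exact h hB'

/-- **`C` splits the current state** (a union of blocks). [cite: JozsaLinden2003, §3 (proof of lemma ratpbl, Case 2)] -/
theorem splits_touchUnion {ψ : QReg N → ℂ} {P : Finset (Finset (Fin N))} (hP : IsBlockPartition ψ P)
    (E : Finset (Fin N)) : Splits ψ (touchUnion P E) :=
  splits_sup_id _ fun _ hB => hP.splits _ (mem_of_mem_touching hB)

/-- **At most `#E` blocks are touched** (distinct blocks meet `E` in distinct wires). [folklore] -/
theorem card_touching_le {ψ : QReg N → ℂ} {P : Finset (Finset (Fin N))} (hP : IsBlockPartition ψ P)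
    (E : Finset (Fin N)) : (touching P E).card ≤ E.card := by
  classical
  let f : Fin N → Finset (Fin N) := fun i => (hP.cover i).choose
  have hf : ∀ i, f i ∈ P ∧ i ∈ f i := fun i => (hP.cover i).choose_spec
  have hsub : touching P E ⊆ E.image f := by
    intro B hB
    obtain ⟨i, hi⟩ := (mem_filter.1 hB).2
    rw [mem_inter] at hi
    exact mem_image.2 ⟨i, hi.2, hP.eq_of_mem (hf i).1 (mem_of_mem_touching hB) (hf i).2 hi.1⟩
  exact (card_le_card hsub).trans card_image_le

/-- **`|C| ≤ #E · p`** when all blocks have at most `p` wires. [cite: JozsaLinden2003, §3 (proof of lemma ratpbl, Case 2: "a unitary matrix of size at most 2^{2p} × 2^{2p}")] -/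
theorem card_touchUnion_le {ψ : QReg N → ℂ} {P : Finset (Finset (Fin N))} (hP : IsBlockPartition ψ P)
    {p : ℕ} (hp : ∀ B ∈ P, B.card ≤ p) (E : Finset (Fin N)) : (touchUnion P E).card ≤ E.card * p := by
  unfold touchUnion
  rw [Finset.sup_eq_biUnion]
  refine card_biUnion_le.trans ?_
  refine (Finset.sum_le_card_nsmul _ _ p fun B hB => ?_).trans ?_
  · exact hp B (mem_of_mem_touching hB)
  · rw [smul_eq_mul]
    exact Nat.mul_le_mul_right p (card_touching_le hP E)

/-- The wire set of an oracle-free Clifford+`T` gate has at most two wires. [cite: JozsaLinden2003, §2 ("a fixed finite set of 2-qubit gates")] -/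
theorem card_wires_le_two (g : QGate cliffordT N) (hg : g.IsOracleFree) : g.wires.card ≤ 2 := by
  rcases g with ⟨op, e⟩ | ⟨_, _⟩
  · cases op <;> simp only [QGate.wires, card_map, card_univ, Fintype.card_fin] <;> decide
  · exact absurd hg id

/-! ### The block invariant -/

/-- An oracle-free gate is a placed gate symbol. [folklore] -/
theorem exists_eq_gate_of_isOracleFree {n : ℕ} {g : QGate G n} (hg : g.IsOracleFree) :
    ∃ (op : G.Op) (e : Fin (G.arity op) ↪ Fin n), g = QGate.gate op e := by
  cases g with
  | gate op e => exact ⟨op, e, rfl⟩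
  | oracle k e => exact absurd hg id

/-- **The blocks after `j` gates form a block partition of the state after `j` gates.** Kept
blocks avoid the gate and keep splitting by locality; inside the union `C` of the touched blocks
(which splits the new state, the gate acting inside `C`) the new blocks are the atoms of the new
state, which split, are pairwise disjoint, cover `C` and avoid the kept blocks.
[cite: JozsaLinden2003, §3 (proof of lemma ratpbl, (a) and Cases 1, 2)] -/
theorem isBlockPartition_blocksAfter (hF : F.IsOracleFree) :
    ∀ j, IsBlockPartition (F.stateAfter x j) (blocksAfter F x j)
  | 0 => by
    rw [stateAfter_zero]
    exact isBlockPartition_singletons _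
  | j + 1 => by
    have IH := isBlockPartition_blocksAfter hF j
    by_cases hj : j < (F.circ x.length).gates.length
    swap
    · rw [blocksAfter_succ_of_le F x (not_lt.1 hj),
        stateAfter_of_length_le F x (Nat.le_succ_of_le (not_lt.1 hj)),
        ← stateAfter_of_length_le F x (not_lt.1 hj)]
      exact IH
    obtain ⟨op, e, hg⟩ := exists_eq_gate_of_isOracleFree (hF x.length _ (List.getElem_mem hj))
    have hψ' : F.stateAfter x (j + 1) = placeGate e (G.mat op) *ᵥ F.stateAfter x j := by
      rw [stateAfter_succ F x hj, hg, QGate.toMatrix_gate]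
    have hE : ((F.circ x.length).gates[j]).wires = univ.map e := by
      rw [hg]
      rfl
    rw [blocksAfter_succ F x hj, hE]
    set P := blocksAfter F x j with hPdef
    set E : Finset (Fin (x.length + F.ancillas x.length)) := univ.map e with hEdef
    have hEe : ∀ k, e k ∈ E := fun k => by simp [hEdef]
    -- `C` splits the new state, kept blocks split the new state
    have hC : Splits (F.stateAfter x (j + 1)) (touchUnion P E) := by
      rw [hψ']
      exact (splits_touchUnion IH E).placeGate_mulVec e (fun k => subset_touchUnion IH E (hEe k)) _
    have hkept : ∀ B ∈ P, B ∉ touching P E → Splits (F.stateAfter x (j + 1)) B := fun B hB hBt => by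
      rw [hψ']
      exact (IH.splits B hB).placeGate_mulVec_of_disjoint e
        (fun k hk => Finset.disjoint_left.1 (disjoint_of_not_mem_touching hB hBt) hk (hEe k)) _
    set ψ' := F.stateAfter x (j + 1) with hψ'def
    constructor
    · intro i
      by_cases hiC : i ∈ touchUnion P E
      · exact ⟨atom ψ' i, mem_union_right _ (mem_image_of_mem _ hiC), mem_atom_self ψ' i⟩
      · obtain ⟨B, hB, hiB⟩ := IH.cover i
        have hBt : B ∉ touching P E := fun h => hiC (subset_touchUnion_of_mem h hiB)
        exact ⟨B, mem_union_left _ (mem_sdiff.2 ⟨hB, hBt⟩), hiB⟩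
    · intro B₁ h₁ B₂ h₂ hne
      rcases mem_union.1 h₁ with h₁ | h₁ <;> rcases mem_union.1 h₂ with h₂ | h₂
      · exact IH.disjoint B₁ (mem_sdiff.1 h₁).1 B₂ (mem_sdiff.1 h₂).1 hne
      · obtain ⟨i, hiC, rfl⟩ := mem_image.1 h₂
        exact (disjoint_touchUnion_of_not_mem_touching IH (mem_sdiff.1 h₁).1 (mem_sdiff.1 h₁).2).mono_right
          (atom_subset_of_splits hC hiC)
      · obtain ⟨i, hiC, rfl⟩ := mem_image.1 h₁
        exact ((disjoint_touchUnion_of_not_mem_touching IH (mem_sdiff.1 h₂).1 (mem_sdiff.1 h₂).2).mono_right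
          (atom_subset_of_splits hC hiC)).symm
      · obtain ⟨i, -, rfl⟩ := mem_image.1 h₁
        obtain ⟨i', -, rfl⟩ := mem_image.1 h₂
        exact Finset.disjoint_left.2 fun k hk hk' => hne (by rw [← atom_eq_of_mem hk, atom_eq_of_mem hk'])
    · intro B hB
      rcases mem_union.1 hB with hB | hB
      · exact IH.nonempty B (mem_sdiff.1 hB).1
      · obtain ⟨i, -, rfl⟩ := mem_image.1 hB
        exact ⟨i, mem_atom_self ψ' i⟩
    · intro B hB
      rcases mem_union.1 hB with hB | hB
      · exact hkept B (mem_sdiff.1 hB).1 (mem_sdiff.1 hB).2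
      · obtain ⟨i, -, rfl⟩ := mem_image.1 hB
        exact splits_atom ψ' i

/-- **The union `C` of the touched blocks splits the new state too** (the gate acts inside `C`).
[cite: JozsaLinden2003, §3 (proof of lemma ratpbl, Case 2)] -/
theorem splits_touchUnion_succ (hF : F.IsOracleFree) {j : ℕ} (hj : j < (F.circ x.length).gates.length) :
    Splits (F.stateAfter x (j + 1)) (touchUnion (blocksAfter F x j) ((F.circ x.length).gates[j]).wires) := by
  obtain ⟨op, e, hg⟩ := exists_eq_gate_of_isOracleFree (hF x.length _ (List.getElem_mem hj))
  rw [stateAfter_succ F x hj, hg, QGate.toMatrix_gate]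
  exact (splits_touchUnion (isBlockPartition_blocksAfter hF j) _).placeGate_mulVec e
    (fun k => subset_touchUnion (isBlockPartition_blocksAfter hF j) _ (by simp [QGate.wires])) _

/-- **The wires of the gate lie inside `C`.** [folklore] -/
theorem wires_subset_touchUnion (hF : F.IsOracleFree) (j : ℕ) {i : ℕ} (hi : i < (F.circ x.length).gates.length) :
    ((F.circ x.length).gates[i]).wires ⊆ touchUnion (blocksAfter F x j) ((F.circ x.length).gates[i]).wires :=
  subset_touchUnion (isBlockPartition_blocksAfter hF j) _

/-! ### Sizes under the hypothesis of theorem `pblthm` -/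

/-- **Every block has at most `p` wires** under `HasPBlockedStates p` (singletons: `p ≥ 1` because
the atom of a wire has at most `p` wires; later blocks are atoms of some intermediate state).
[cite: JozsaLinden2003, §3 (theorem pblthm, hypothesis; proof of lemma ratpbl: "blocks of size ≤ p")] -/
theorem card_le_of_mem_blocksAfter {p : ℕ} (hp : F.HasPBlockedStates p) :
    ∀ j, ∀ B ∈ blocksAfter F x j, B.card ≤ p
  | 0 => by
    intro B hB
    obtain ⟨i, -, rfl⟩ := mem_image.1 hB
    rw [card_singleton]
    exact le_trans (card_pos.2 ⟨i, mem_atom_self _ i⟩) (hp.card_atom_stateAfter_le x 0 i)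
  | j + 1 => by
    intro B hB
    by_cases hj : j < (F.circ x.length).gates.length
    · rw [blocksAfter_succ F x hj] at hB
      rcases mem_union.1 hB with hB | hB
      · exact card_le_of_mem_blocksAfter hp j B (mem_sdiff.1 hB).1
      · obtain ⟨i, -, rfl⟩ := mem_image.1 hB
        exact hp.card_atom_stateAfter_le x (j + 1) i
    · rw [blocksAfter_succ_of_le F x (not_lt.1 hj)] at hB
      exact card_le_of_mem_blocksAfter hp j B hB

/-- **`|C| ≤ 2p`** for a Clifford+`T` family under `HasPBlockedStates p`: the merged table of the
simulation never exceeds `2^{2p} × 2^{2p}` entries. [cite: JozsaLinden2003, §3 (proof of lemma ratpbl, Case 2)] -/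
theorem card_touchUnion_blocksAfter_le {F : QCircuitFamily cliffordT} {x : List Bool} {p : ℕ}
    (hF : F.IsOracleFree) (hp : F.HasPBlockedStates p) (j : ℕ) {i : ℕ}
    (hi : i < (F.circ x.length).gates.length) :
    (touchUnion (blocksAfter F x j) ((F.circ x.length).gates[i]).wires).card ≤ 2 * p :=
  (card_touchUnion_le (isBlockPartition_blocksAfter hF j) (card_le_of_mem_blocksAfter hp j) _).trans
    (Nat.mul_le_mul_right p (card_wires_le_two _ (hF x.length _ (List.getElem_mem hi))))

end Blocks

end Literature.Barriers.QuantumAdvantage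

end
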